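import Literature.MathematicalPhysics.QuantumLattice.TypeClassSidecarReaderTPrimeUBox
import Literature.MathematicalPhysics.QuantumLattice.TorusSectorPressureTypeBoundFillingBox
import HarnessLib

/-!
# The FILLING leg of the «c2-sector» sidecar reader: TWO checked types on ONE sidecar's floors word every density
# between them — on every torus, jointly with the `(t', U)`-box (the 3-CELL `(t', U, n)` at `T > 0`)

Family `hubbard` (topic `MathematicalPhysics/QuantumLattice`), seat hubbard-downfold-unc-2 (the FILLING direction of «a parameter
BOX maps to a certified word»; here joined with hubbard-thermal-p2's `t'`-transport and hubbard-downfold-unc-1's `U`-transport). The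
material oracle's boxes are 3-CELLS `(t', U, n) ∈ [s₀ ± σ₂] × [U₁, U₂] × [ρ₁, ρ₂]` (fast cell: `(−1/4 ± 1/20) × [15/2, 17/2] × [173/200, 177/200]`);
`TypeClassSidecarReaderTPrimeUBox` words the `(t', U)` rectangle at ONE filling `n = 2A₀/(q a b)` (the density of the sidecar's base
type). The filling direction needs no transport of the certified floors at all: the per-sector floors
`z_s ≤ Re Z_β(H^open_{a×b}; s)` of a sidecar do not know the density — only the balanced base TYPE does — and two balanced types
`m₁` (`q₁`, `A₁`, `ρ₁ = 2A₁/(q₁ab)`) and `m₂` (`q₂`, `A₂`, `ρ₂`) on the SAME floors give the chord floor `(1−λ)W₁ + λW₂` at every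
density `(1−λ)ρ₁ + λρ₂` (`TorusSectorPressureTypeBoundFillingBox`, the method of types with two block species). This file makes that
KERNEL-EXECUTABLE in p2's row format and composes it with the `(t', U)`-box reader:

* §1 two row lists with the same SKELETON `(sector, zn, ze)` define the same sector set and the same floors
  (`c2Sectors_eq_of_skeleton_eq`, `c2Floor_eq_of_skeleton_eq`; the skeleton equation is `decide`/`rfl` for row files);
* §2 `eventually_pressureFloor_chord_of_c2Check₂`: two lists passing `c2Check` (`(q₁, A₁, W₁)`, `(q₂, A₂, W₂)`, `A₁q₂ ≤ A₂q₁`) with a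
  common skeleton and ONE claim node (for the first list) give, along ANY `Ls → ∞` and for every `λ ∈ [0, 1]`,
  `∀ ε > 0, ∀ᶠ j, (((1−λ)W₁ + λW₂) − ε)(Ls j)² ≤ log Re Z_β(sectorHamiltonianTT' t t' U n (Ls j))` at `n = (1−λ)ρ₁ + λρ₂ < 2`;
  `…_of_mem_Icc`: the same indexed by `n ∈ [ρ₁, ρ₂]` with the chord written `W₁ + (n − ρ₁)/(ρ₂ − ρ₁)·(W₂ − W₁)`;
* §3 the 3-CELL READER `IsTorusLimitOfMixture.meanEnergy_hubbardTTPrime_le_of_c2Check₂_of_cornerMarkovCertificate_tPrimeUBox_allTori_anchorU_kinematic`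
  (+ rectangle / decimal `16212/10000` edition `…rectMarkovCertificate…'`): sidecar AT `(β, t, s₀, U₀)` with two checked types, `t' = 0`
  corner Markov certificate at `(β_h, μ, U₀)`; for every torus limit at `(β, t, s, U, n)` with `|s| ≤ σ₁`, `|s − s₀| ≤ σ₂`,
  `ρ₁ ≤ n ≤ ρ₂` (`n < 2`, `0 < β_h < β`):
  `e_Φ(ω) ≤ (((c − β_h μ n) + β_h σ₁ 16/π²) + β_h·max(U₀ − U, 0)·n/2 − (((W₁ + (n−ρ₁)/(ρ₂−ρ₁)(W₂ − W₁)) − β σ₂ 16/π²) − β·max(U − U₀, 0)·n/2))/(β − β_h)`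
  — affine in `n` at fixed `(s, U)`, so a cell word is read at the two endpoint fillings.

Everything is PROVED; no definition, no named fact, no number. HONEST SCOPE: the chord lies below the optimal type value at
interior densities (re-typing at more densities tightens it); the `t'`/`U` prices are the kinematic ones of the imported readers;
nothing moves in `β`. WHAT THIS IS NOT: no certificate, no phase sentence.

## Mathlib / tree search

REUSED: `c2Check_sound`, `c2Floor_le_of_rows`, `c2Sectors`/`c2Type`/`c2Floor` (`TypeClassSidecarReader`);
`InfVolFermionState.eventually_typeFreeEntropy_chord_mul_sq_le_log_partitionFn_allTori` (`TorusSectorPressureTypeBoundFillingBox`);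
`eventually_mul_sq_le_log_partitionFn_sector_of_tPrime_anchor_floor`, `sixteen_div_pi_sq_lt` (`TypeClassSidecarReaderTPrimeTransport`);
`eventually_log_partitionFn_sector_le_of_cornerMarkovCertificate_tPrimeTransport` (`TypeClassSidecarReaderUCellTPrime` §0);
`IsTorusLimitOfMixture.meanEnergy_hubbardTTPrime_le_of_pressure_bounds_anchorU_kinematic` (`HubbardTTPrimePressureFloorUTransport` §6);
rectangle bookkeeping (`HubbardTorusMarkovRectWindow`). `rg 'c2Check₂|FillingBox' Literature/MathematicalPhysics/QuantumLattice` (2026-08-27):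
only the raw-type interval theorems of this seat (`TorusSectorPressureTypeBoundFillingBox`, `HubbardThermalAxisWindowFillingBox`), no row-format reader.

## References

* D. Ruelle, *Statistical Mechanics: Rigorous Results* (1969), §3.3 eqs. (3.11)–(3.18), §3.4.3. [cite: Ruelle1969, §3.3 (3.11)–(3.18)]
* R. B. Israel, *Convexity in the Theory of Lattice Gases* (1979), Thm. I.3.4, Lemma II.3.1. [cite: Israel1979, Lemma II.3.1]
* T. M. Cover, J. A. Thomas, *Elements of Information Theory* (2006), Thm. 11.1.3. [cite: CoverThomas2006, Theorem 11.1.3]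
* E. H. Lieb, Commun. Math. Phys. 31 (1973) 327, §V (5.2)–(5.4). [cite: Lieb1973, §V (5.2)–(5.4)]
* D. Poulin, M. B. Hastings, Phys. Rev. Lett. 106 (2011) 080403, eqs. (3)–(8). [cite: PoulinHastings2011, eqs. (3)–(8)]
-/

noncomputable section

namespace Literature.MathematicalPhysics.QuantumLattice

open Matrix Finset HubbardWave0 ThermodynamicLimit LiebThm1 AndersonCluster Literature.Probability.LatticeModels
open _root_.Filter
open scoped _root_.Topology ComplexOrder BigOperators

/-! ### §1 Two row lists with the same skeleton `(sector, zn, ze)` -/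

/-- Two sidecar row lists with the same skeleton `(sector, zn, ze)` (same order) have the same sector set.
[cite: CoverThomas2006, Theorem 11.1.3] -/
theorem c2Sectors_eq_of_skeleton_eq {rows₁ rows₂ : List C2Row}
    (h : rows₁.map (fun r => (r.sec, r.zn, r.ze)) = rows₂.map (fun r => (r.sec, r.zn, r.ze))) :
    c2Sectors rows₁ = c2Sectors rows₂ := by
  have h1 : rows₁.map C2Row.sec = rows₂.map C2Row.sec := by
    have := congrArg (List.map Prod.fst) h
    simpa [List.map_map, Function.comp_def] using this
  unfold c2Sectors
  rw [h1]

/-- The floors of a row list depend only on its skeleton: `c2Floor rows s` as a function of `rows.map (sector, zn, ze)`.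
[cite: Ruelle1969, §3.3] -/
theorem c2Floor_eq_skeleton (rows : List C2Row) (s : ℕ × ℕ) :
    c2Floor rows s = (((rows.map fun r => (r.sec, r.zn, r.ze)).filter fun p => p.1 = s).map
      fun p => (p.2.1 : ℝ) / 2 ^ p.2.2).sum := by
  unfold c2Floor
  rw [List.filter_map, List.map_map]
  rfl

/-- Two sidecar row lists with the same skeleton have the same floors. [cite: Ruelle1969, §3.3] -/
theorem c2Floor_eq_of_skeleton_eq {rows₁ rows₂ : List C2Row}
    (h : rows₁.map (fun r => (r.sec, r.zn, r.ze)) = rows₂.map (fun r => (r.sec, r.zn, r.ze))) :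
    c2Floor rows₁ = c2Floor rows₂ := by
  funext s
  rw [c2Floor_eq_skeleton, c2Floor_eq_skeleton, h]

/-! ### §2 The chord floor on every torus from two checked types on one sidecar's floors -/

namespace InfVolFermionState

variable {t s U n β : ℝ} {ω : InfVolFermionState 2} {Ls : ℕ → ℕ}

/-- **The C2 pressure floor at an interpolated density from TWO checked row lists with a common skeleton, every torus.**
`rows₁` passes `c2Check P₁ K₁ q₁ A₁ a b rows₁ W₁num W₁den`, `rows₂` passes `c2Check P₂ K₂ q₂ A₂ a b rows₂ W₂num W₂den`, both have
the same skeleton `(sector, zn, ze)`, `A₁q₂ ≤ A₂q₁`, and the claim node holds for `rows₁` at `(β, t, t', U)`; `λ ∈ [0, 1]`,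
`n q₁q₂ab = 2((1−λ)A₁q₂ + λA₂q₁)`, `n < 2`. Then along any `Ls → ∞`:
`∀ ε > 0, ∀ᶠ j, (((1−λ)W₁num/W₁den + λW₂num/W₂den) − ε)(Ls j)² ≤ log Re Z_β(sectorHamiltonianTT' t t' U n (Ls j))`.
[cite: Ruelle1969, §3.3 (3.11)–(3.18)] [cite: CoverThomas2006, Theorem 11.1.3] [cite: Israel1979, Lemma II.3.1] -/
theorem eventually_pressureFloor_chord_of_c2Check₂ (t t' U n : ℝ) {β : ℝ} (hβ : 0 ≤ β) {a b : ℕ} (ha : 1 ≤ a)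
    (hb : 1 ≤ b) {rows₁ rows₂ : List C2Row} {P₁ K₁ P₂ K₂ q₁ q₂ A₁ A₂ : ℕ} {W₁num W₂num : ℤ} {W₁den W₂den : ℕ}
    (h₁ : c2Check P₁ K₁ q₁ A₁ a b rows₁ W₁num W₁den = true) (h₂ : c2Check P₂ K₂ q₂ A₂ a b rows₂ W₂num W₂den = true)
    (hskel : rows₁.map (fun r => (r.sec, r.zn, r.ze)) = rows₂.map (fun r => (r.sec, r.zn, r.ze)))
    (hρ : A₁ * q₂ ≤ A₂ * q₁) {lam : ℝ} (hlam0 : 0 ≤ lam) (hlam1 : lam ≤ 1)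
    (hn : n * ((q₁ : ℝ) * q₂ * a * b) = 2 * ((1 - lam) * A₁ * q₂ + lam * A₂ * q₁)) (hn2 : n < 2)
    (hnode : ∀ r ∈ rows₁,
      r.floor ≤ (partitionFn β (spinSectorHamiltonian r.nu r.nd (hubbardOpenBoxTT' a b t t' U))).re)
    (hLs : Tendsto Ls atTop atTop) {ε : ℝ} (hε : 0 < ε) :
    ∀ᶠ j in atTop, (((1 - lam) * ((W₁num : ℝ) / W₁den) + lam * ((W₂num : ℝ) / W₂den)) - ε) * (Ls j : ℝ) ^ 2 ≤
      Real.log (partitionFn β (sectorHamiltonianTT' t t' U n (Ls j))).re := by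
  obtain ⟨hnd₁, hq₁, hm₁S, hsum₁, hA₁, hB₁, hz0, hW₁⟩ := c2Check_sound h₁ ha hb
  obtain ⟨-, hq₂, hm₂S, hsum₂, hA₂, hB₂, -, hW₂⟩ := c2Check_sound h₂ ha hb
  have hS := c2Sectors_eq_of_skeleton_eq hskel
  have hF := c2Floor_eq_of_skeleton_eq hskel
  rw [← hS] at hm₂S hsum₂ hA₂ hB₂ hW₂
  rw [← hF] at hW₂
  have hz : ∀ s ∈ c2Sectors rows₁,
      c2Floor rows₁ s ≤ (partitionFn β (spinSectorHamiltonian s.1 s.2 (hubbardOpenBoxTT' a b t t' U))).re :=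
    c2Floor_le_of_rows hnd₁
      (F := fun s => (partitionFn β (spinSectorHamiltonian s.1 s.2 (hubbardOpenBoxTT' a b t t' U))).re)
      fun r hr => hnode r hr
  have hmain := eventually_typeFreeEntropy_chord_mul_sq_le_log_partitionFn_allTori t t' U n hβ ha hb
    (c2Sectors rows₁) (c2Type rows₁) (c2Type rows₂) hq₁ hq₂ hm₁S hm₂S hsum₁ hsum₂ hA₁ hB₁ hA₂ hB₂ hρ hlam0 hlam1
    hn hn2 hz0 hz hLs hε
  filter_upwards [hmain] with j hj
  refine le_trans (mul_le_mul_of_nonneg_right ?_ (sq_nonneg _)) hj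
  have h1 := mul_le_mul_of_nonneg_left hW₁ (sub_nonneg.2 hlam1)
  have h2 := mul_le_mul_of_nonneg_left hW₂ hlam0
  linarith

/-- **The same floor indexed by the density `n ∈ [ρ₁, ρ₂]`** (`ρ_i (q_i a b) = 2A_i`, `ρ₁ < ρ₂`, `n < 2`): along any `Ls → ∞`,
`∀ ε > 0, ∀ᶠ j, ((W₁ + (n − ρ₁)/(ρ₂ − ρ₁)·(W₂ − W₁)) − ε)(Ls j)² ≤ log Re Z_β(sectorHamiltonianTT' t t' U n (Ls j))`
(`W_i = W_inum/W_iden`): the chord of the two type values, affine in `n`.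
[cite: Ruelle1969, §3.3 (3.11)–(3.18)] [cite: Israel1979, Lemma II.3.1] -/
theorem eventually_pressureFloor_chord_of_c2Check₂_of_mem_Icc (t t' U n : ℝ) {β : ℝ} (hβ : 0 ≤ β) {a b : ℕ}
    (ha : 1 ≤ a) (hb : 1 ≤ b) {rows₁ rows₂ : List C2Row} {P₁ K₁ P₂ K₂ q₁ q₂ A₁ A₂ : ℕ} {W₁num W₂num : ℤ}
    {W₁den W₂den : ℕ}
    (h₁ : c2Check P₁ K₁ q₁ A₁ a b rows₁ W₁num W₁den = true) (h₂ : c2Check P₂ K₂ q₂ A₂ a b rows₂ W₂num W₂den = true)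
    (hskel : rows₁.map (fun r => (r.sec, r.zn, r.ze)) = rows₂.map (fun r => (r.sec, r.zn, r.ze)))
    {ρ₁ ρ₂ : ℝ} (hρ₁ : ρ₁ * ((q₁ : ℝ) * a * b) = 2 * A₁) (hρ₂ : ρ₂ * ((q₂ : ℝ) * a * b) = 2 * A₂) (hρ : ρ₁ < ρ₂)
    (hn1 : ρ₁ ≤ n) (hn2' : n ≤ ρ₂) (hn2 : n < 2)
    (hnode : ∀ r ∈ rows₁,
      r.floor ≤ (partitionFn β (spinSectorHamiltonian r.nu r.nd (hubbardOpenBoxTT' a b t t' U))).re)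
    (hLs : Tendsto Ls atTop atTop) {ε : ℝ} (hε : 0 < ε) :
    ∀ᶠ j in atTop, ((((W₁num : ℝ) / W₁den) + (n - ρ₁) / (ρ₂ - ρ₁) * (((W₂num : ℝ) / W₂den) - ((W₁num : ℝ) / W₁den))) - ε) *
        (Ls j : ℝ) ^ 2 ≤ Real.log (partitionFn β (sectorHamiltonianTT' t t' U n (Ls j))).re := by
  obtain ⟨-, hq₁, -⟩ := c2Check_sound h₁ ha hb
  obtain ⟨-, hq₂, -⟩ := c2Check_sound h₂ ha hb
  have hq₁r : (0 : ℝ) < q₁ := by exact_mod_cast hq₁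
  have hq₂r : (0 : ℝ) < q₂ := by exact_mod_cast hq₂
  have har : (0 : ℝ) < a := by exact_mod_cast ha
  have hbr : (0 : ℝ) < b := by exact_mod_cast hb
  set lam : ℝ := (n - ρ₁) / (ρ₂ - ρ₁) with hlam
  have hd : 0 < ρ₂ - ρ₁ := sub_pos.2 hρ
  have hlam0 : 0 ≤ lam := div_nonneg (sub_nonneg.2 hn1) hd.le
  have hlam1 : lam ≤ 1 := (div_le_one hd).2 (by linarith)
  have hnlam : n = (1 - lam) * ρ₁ + lam * ρ₂ := by
    rw [hlam]; field_simp; ring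
  -- the natural-number order of the densities
  have hρnat : A₁ * q₂ ≤ A₂ * q₁ := by
    have h1 : (ρ₁ : ℝ) * ((q₁ : ℝ) * a * b) * q₂ ≤ ρ₂ * ((q₂ : ℝ) * a * b) * q₁ := by
      have : ρ₁ * ((q₁ : ℝ) * a * b) * q₂ - ρ₂ * ((q₂ : ℝ) * a * b) * q₁ = (ρ₁ - ρ₂) * (q₁ * q₂ * a * b) := by ring
      nlinarith [mul_pos (mul_pos (mul_pos hq₁r hq₂r) har) hbr]
    rw [hρ₁, hρ₂] at h1
    have h2 : ((A₁ * q₂ : ℕ) : ℝ) ≤ ((A₂ * q₁ : ℕ) : ℝ) := by push_cast; linarith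
    exact_mod_cast h2
  have hn : n * ((q₁ : ℝ) * q₂ * a * b) = 2 * ((1 - lam) * A₁ * q₂ + lam * A₂ * q₁) := by
    have e1 : 2 * ((1 - lam) * (A₁ : ℝ) * q₂ + lam * A₂ * q₁) =
        (1 - lam) * (2 * (A₁ : ℝ)) * q₂ + lam * (2 * (A₂ : ℝ)) * q₁ := by ring
    rw [e1, ← hρ₁, ← hρ₂, hnlam]; ring
  have hmain := eventually_pressureFloor_chord_of_c2Check₂ t t' U n hβ ha hb h₁ h₂ hskel hρnat hlam0 hlam1 hn hn2 hnode
    hLs hε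
  filter_upwards [hmain] with j hj
  refine le_trans (le_of_eq ?_) hj
  congr 1
  rw [hlam]
  ring

/-! ### §3 The 3-CELL reader: `(t', U)`-box from one anchor `(s₀, U₀)` × filling interval `[ρ₁, ρ₂]` -/

/-- **JOINT `(t', U, n)`-CELL from ONE sidecar and TWO checked types**: sidecar AT `(β, t, s₀, U₀)` with row lists `rows₁`
(`q₁, A₁, W₁`, density `ρ₁`) and `rows₂` (`q₂, A₂, W₂`, density `ρ₂ > ρ₁`) of the same skeleton and the claim node of `rows₁`;
`t' = 0` CORNER Markov certificate at `(β_h, μ, U₀)`; for every torus limit at `(β, t, s, U, n)` with `|s| ≤ σ₁`, `|s − s₀| ≤ σ₂`,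
`ρ₁ ≤ n ≤ ρ₂` (`n < 2`, `0 < β_h < β`):
`e_Φ(ω) ≤ ((((c − β_h μ n) + β_h σ₁ 16/π²) + β_h·max(U₀ − U, 0)·n/2) − (((W₁ + (n−ρ₁)/(ρ₂−ρ₁)(W₂ − W₁)) − β σ₂ 16/π²) − β·max(U − U₀, 0)·n/2))/(β − β_h)`.
[cite: Israel1979, Lemma II.3.1] [cite: Ruelle1969, §3.3 (3.11)–(3.18)] [cite: Lieb1973, §V (5.2)–(5.4)] [cite: PoulinHastings2011, eqs. (3)–(8)] -/
theorem IsTorusLimitOfMixture.meanEnergy_hubbardTTPrime_le_of_c2Check₂_of_cornerMarkovCertificate_tPrimeUBox_allTori_anchorU_kinematic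
    (hn2 : n < 2) {s₀ σ₁ σ₂ : ℝ} (hσ₁ : |s| ≤ σ₁) (hσ₂ : |s - s₀| ≤ σ₂) (U₀ : ℝ)
    (h : ω.IsTorusLimitOfMixture (sectorGibbsCount n) (fun L => sectorGibbsWeightTT' β t s U n L)
      (fun L => sectorGibbsVectorTT' t s U n L) Ls)
    (hLs : Tendsto Ls atTop atTop) {βh : ℝ} (hβh : 0 < βh) (hlt : βh < β)
    -- C2 at `(β, t, s₀, U₀)`: two checked types on one skeleton
    {a b : ℕ} (ha : 1 ≤ a) (hb : 1 ≤ b) {rows₁ rows₂ : List C2Row} {P₁ K₁ P₂ K₂ q₁ q₂ A₁ A₂ : ℕ}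
    {W₁num W₂num : ℤ} {W₁den W₂den : ℕ}
    (h₁ : c2Check P₁ K₁ q₁ A₁ a b rows₁ W₁num W₁den = true) (h₂ : c2Check P₂ K₂ q₂ A₂ a b rows₂ W₂num W₂den = true)
    (hskel : rows₁.map (fun r => (r.sec, r.zn, r.ze)) = rows₂.map (fun r => (r.sec, r.zn, r.ze)))
    {ρ₁ ρ₂ : ℝ} (hρ₁ : ρ₁ * ((q₁ : ℝ) * a * b) = 2 * A₁) (hρ₂ : ρ₂ * ((q₂ : ℝ) * a * b) = 2 * A₂) (hρ : ρ₁ < ρ₂)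
    (hn1 : ρ₁ ≤ n) (hn2' : n ≤ ρ₂)
    (hnode : ∀ r ∈ rows₁,
      r.floor ≤ (partitionFn β (spinSectorHamiltonian r.nu r.nd (hubbardOpenBoxTT' a b t s₀ U₀))).re)
    -- C1 (corner window, `t' = 0`) at `(βh, μ, U₀)`
    (μ : ℝ) {Λ : Finset (Site 2)} {x₀ : Site 2} (hx₀ : x₀ ∈ Λ) (hmax : ∀ y ∈ Λ, toLex y ≤ toLex x₀)
    (hcorner : ∀ i : Fin 2, x₀ - unitVec i ∈ Λ) {ℓw : ℕ} (hΛ : Λ ⊆ halfOpenBox 2 ℓw)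
    {ι : Type*} (sι : Finset ι) (Sw : ι → Finset (Site 2)) (hS : ∀ i, Sw i ⊆ Λ) (zw : ι → Site 2)
    (hzw : ∀ i, shiftSet (zw i) (Sw i) ⊆ Λ) {O : ∀ i, FermionOp (Sw i)} (hO : ∀ i ∈ sι, (O i).IsHermitian)
    (g : ι → ℝ) {LB : FermionOp (Λ.erase x₀)} (hLB : LB.IsHermitian) {c : ℝ}
    (hcert : ((Real.exp c : ℂ) • cfc Real.exp LB -
      fermionPartialTrace (PolySite.incl (Finset.erase_subset x₀ Λ))
        (cfc Real.exp (-((βh : ℂ) • (cornerEnergyRep Λ x₀ t U₀ μ + windowAnnihilator sι Λ Sw hS zw hzw O g)) +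
          fermionEmbed (PolySite.incl (Finset.erase_subset x₀ Λ)) LB))).PosSemidef) :
    ω.meanEnergy (hubbardTTPrimeFermionInteraction t s U) 1 ≤
      ((((c - βh * μ * n) + βh * σ₁ * (16 / Real.pi ^ 2)) + βh * max (U₀ - U) 0 * (n / 2)) -
        (((((W₁num : ℝ) / W₁den) + (n - ρ₁) / (ρ₂ - ρ₁) * (((W₂num : ℝ) / W₂den) - ((W₁num : ℝ) / W₁den))) -
          β * σ₂ * (16 / Real.pi ^ 2)) - β * max (U - U₀) 0 * (n / 2))) / (β - βh) := by
  obtain ⟨-, hq₁, -⟩ := c2Check_sound h₁ ha hb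
  -- `0 ≤ ρ₁ ≤ n`
  have hn0 : 0 ≤ n := by
    have hq₁r : (0 : ℝ) < q₁ := by exact_mod_cast hq₁
    have har : (0 : ℝ) < a := by exact_mod_cast ha
    have hbr : (0 : ℝ) < b := by exact_mod_cast hb
    have hpos : 0 < (q₁ : ℝ) * a * b := by positivity
    have hA : (0 : ℝ) ≤ 2 * A₁ := by positivity
    have hρ₁0 : 0 ≤ ρ₁ := (mul_nonneg_iff_of_pos_right hpos).1 (by rw [hρ₁]; exact hA)
    linarith
  have hβ : 0 < β := hβh.trans hlt
  have hK0 : 0 ≤ 16 / Real.pi ^ 2 := by positivity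
  set Wc : ℝ := ((W₁num : ℝ) / W₁den) + (n - ρ₁) / (ρ₂ - ρ₁) * (((W₂num : ℝ) / W₂den) - ((W₁num : ℝ) / W₁den))
    with hWc
  -- cold input at `(β, t, s₀, U₀)`: the chord floor of the two types, then transported along `t'`
  have hW0 : ∀ ε : ℝ, 0 < ε → ∀ᶠ j in atTop,
      (Wc - ε) * (Ls j : ℝ) ^ 2 ≤ Real.log (partitionFn β (sectorHamiltonianTT' t s₀ U₀ n (Ls j))).re :=
    fun ε hε => eventually_pressureFloor_chord_of_c2Check₂_of_mem_Icc t s₀ U₀ n hβ.le ha hb h₁ h₂ hskel hρ₁ hρ₂ hρ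
      hn1 hn2' hn2 hnode hLs hε
  have hWs := eventually_mul_sq_le_log_partitionFn_sector_of_tPrime_anchor_floor hn0 hn2 t U₀ hβ s₀ s hLs hW0
  have hWs' : ∀ ε : ℝ, 0 < ε → ∀ᶠ j in atTop,
      ((Wc - β * σ₂ * (16 / Real.pi ^ 2)) - ε) * (Ls j : ℝ) ^ 2 ≤
        Real.log (partitionFn β (sectorHamiltonianTT' t s U₀ n (Ls j))).re := by
    intro ε hε
    filter_upwards [hWs ε hε] with j hj
    refine le_trans (mul_le_mul_of_nonneg_right ?_ (sq_nonneg _)) hj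
    have h2 : β * |s - s₀| * (16 / Real.pi ^ 2) ≤ β * σ₂ * (16 / Real.pi ^ 2) :=
      mul_le_mul_of_nonneg_right (mul_le_mul_of_nonneg_left hσ₂ hβ.le) hK0
    linarith
  -- hot input at `(βh, t, s, U₀)`: corner C1 transported along `t'`, weakened to the `σ₁` form
  have hu := eventually_log_partitionFn_sector_le_of_cornerMarkovCertificate_tPrimeTransport hn0 hn2 t s U₀ hβh hLs μ hx₀ hmax
    hcorner hΛ sι Sw hS zw hzw hO g hLB hcert
  have hu' : ∀ ε : ℝ, 0 < ε → ∀ᶠ j in atTop,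
      Real.log (partitionFn βh (sectorHamiltonianTT' t s U₀ n (Ls j))).re ≤
        (((c - βh * μ * n) + βh * σ₁ * (16 / Real.pi ^ 2)) + ε) * (Ls j : ℝ) ^ 2 := by
    intro ε hε
    filter_upwards [hu ε hε] with j hj
    refine hj.trans (mul_le_mul_of_nonneg_right ?_ (sq_nonneg _))
    have h1 : βh * |s| * (16 / Real.pi ^ 2) ≤ βh * σ₁ * (16 / Real.pi ^ 2) :=
      mul_le_mul_of_nonneg_right (mul_le_mul_of_nonneg_left hσ₁ hβh.le) hK0
    linarith
  exact h.meanEnergy_hubbardTTPrime_le_of_pressure_bounds_anchorU_kinematic hn0 hn2.le U₀ hLs hβh hlt hWs' hu'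

/-- **Rectangle corollary, row-file edition** of the 3-cell reader (`16/π²` replaced by `16212/10000` in both prices):
`e_Φ(ω) ≤ ((((c − β_h μ n) + β_h σ₁ K) + β_h·max(U₀ − U, 0)·n/2) − (((W₁ + (n−ρ₁)/(ρ₂−ρ₁)(W₂ − W₁)) − β σ₂ K) − β·max(U − U₀, 0)·n/2))/(β − β_h)`,
`K = 16212/10000`. [cite: Israel1979, Lemma II.3.1] [cite: Ruelle1969, §3.3 (3.11)–(3.18)] [cite: PoulinHastings2011, eqs. (3)–(8)] -/
theorem IsTorusLimitOfMixture.meanEnergy_hubbardTTPrime_le_of_c2Check₂_of_rectMarkovCertificate_tPrimeUBox_allTori_anchorU_kinematic'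
    (hn2 : n < 2) {s₀ σ₁ σ₂ : ℝ} (hσ₁ : |s| ≤ σ₁) (hσ₂ : |s - s₀| ≤ σ₂) (U₀ : ℝ)
    (h : ω.IsTorusLimitOfMixture (sectorGibbsCount n) (fun L => sectorGibbsWeightTT' β t s U n L)
      (fun L => sectorGibbsVectorTT' t s U n L) Ls)
    (hLs : Tendsto Ls atTop atTop) {βh : ℝ} (hβh : 0 < βh) (hlt : βh < β)
    {a b : ℕ} (ha : 1 ≤ a) (hb : 1 ≤ b) {rows₁ rows₂ : List C2Row} {P₁ K₁ P₂ K₂ q₁ q₂ A₁ A₂ : ℕ}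
    {W₁num W₂num : ℤ} {W₁den W₂den : ℕ}
    (h₁ : c2Check P₁ K₁ q₁ A₁ a b rows₁ W₁num W₁den = true) (h₂ : c2Check P₂ K₂ q₂ A₂ a b rows₂ W₂num W₂den = true)
    (hskel : rows₁.map (fun r => (r.sec, r.zn, r.ze)) = rows₂.map (fun r => (r.sec, r.zn, r.ze)))
    {ρ₁ ρ₂ : ℝ} (hρ₁ : ρ₁ * ((q₁ : ℝ) * a * b) = 2 * A₁) (hρ₂ : ρ₂ * ((q₂ : ℝ) * a * b) = 2 * A₂) (hρ : ρ₁ < ρ₂)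
    (hn1 : ρ₁ ≤ n) (hn2' : n ≤ ρ₂)
    (hnode : ∀ r ∈ rows₁,
      r.floor ≤ (partitionFn β (spinSectorHamiltonian r.nu r.nd (hubbardOpenBoxTT' a b t s₀ U₀))).re)
    (μ : ℝ) {a' b' : ℕ} (ha' : 2 ≤ a') (hb' : 2 ≤ b')
    {ι : Type*} (sι : Finset ι) (Sw : ι → Finset (Site 2)) (hS : ∀ i, Sw i ⊆ rectWindow a' b') (zw : ι → Site 2)
    (hzw : ∀ i, shiftSet (zw i) (Sw i) ⊆ rectWindow a' b') {O : ∀ i, FermionOp (Sw i)}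
    (hO : ∀ i ∈ sι, (O i).IsHermitian) (g : ι → ℝ)
    {LB : FermionOp ((rectWindow a' b').erase (mkSite2 (a' - 1) (b' - 1)))} (hLB : LB.IsHermitian) {c : ℝ}
    (hcert : ((Real.exp c : ℂ) • cfc Real.exp LB -
      fermionPartialTrace (PolySite.incl (Finset.erase_subset (mkSite2 (a' - 1) (b' - 1)) (rectWindow a' b')))
        (cfc Real.exp (-((βh : ℂ) • (cornerEnergyRep (rectWindow a' b') (mkSite2 (a' - 1) (b' - 1)) t U₀ μ +
            windowAnnihilator sι (rectWindow a' b') Sw hS zw hzw O g)) +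
          fermionEmbed (PolySite.incl (Finset.erase_subset (mkSite2 (a' - 1) (b' - 1)) (rectWindow a' b'))) LB))).PosSemidef) :
    ω.meanEnergy (hubbardTTPrimeFermionInteraction t s U) 1 ≤
      ((((c - βh * μ * n) + βh * σ₁ * (16212 / 10000)) + βh * max (U₀ - U) 0 * (n / 2)) -
        (((((W₁num : ℝ) / W₁den) + (n - ρ₁) / (ρ₂ - ρ₁) * (((W₂num : ℝ) / W₂den) - ((W₁num : ℝ) / W₁den))) -
          β * σ₂ * (16212 / 10000)) - β * max (U - U₀) 0 * (n / 2))) / (β - βh) := by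
  have hmain := h.meanEnergy_hubbardTTPrime_le_of_c2Check₂_of_cornerMarkovCertificate_tPrimeUBox_allTori_anchorU_kinematic hn2
    hσ₁ hσ₂ U₀ hLs hβh hlt ha hb h₁ h₂ hskel hρ₁ hρ₂ hρ hn1 hn2' hnode μ (rectCorner_mem_rectWindow (by omega) (by omega))
    toLex_le_toLex_rectCorner (rectCorner_sub_unitVec_mem_rectWindow ha' hb') (rectWindow_subset_halfOpenBox_max a' b')
    sι Sw hS zw hzw hO g hLB hcert
  refine hmain.trans (div_le_div_of_nonneg_right ?_ (by linarith))
  have hK := sixteen_div_pi_sq_lt.le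
  have hσ₁0 : 0 ≤ σ₁ := (abs_nonneg s).trans hσ₁
  have hσ₂0 : 0 ≤ σ₂ := (abs_nonneg _).trans hσ₂
  have h1 := mul_le_mul_of_nonneg_left hK (mul_nonneg hβh.le hσ₁0)
  have h2 := mul_le_mul_of_nonneg_left hK (mul_nonneg (hβh.trans hlt).le hσ₂0)
  linarith

/-! ### §4 The CROSS-CORNER 3-cell: sidecar at `(s₀, U₂)`, corner C1 at `(0, U₁)`, filling interval `[ρ₁, ρ₂]` — NO `U`-price -/

/-- **JOINT `(t', U, n)`-CELL, cross-corner edition (no `U`-price)**: two checked types of one sidecar AT `(β, t, s₀, U₂)` (claim node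
of `rows₁` at `U₂`), `t' = 0` CORNER Markov certificate at `(β_h, μ, U₁)`; for every torus limit at `(β, t, s, U, n)` with
`|s| ≤ σ₁`, `|s − s₀| ≤ σ₂`, `U ∈ [U₁, U₂]`, `ρ₁ ≤ n ≤ ρ₂` (`n < 2`, `0 < β_h < β`):
`e_Φ(ω) ≤ ((c − β_h μ n) + β_h σ₁ 16/π² + β σ₂ 16/π² − (W₁ + (n−ρ₁)/(ρ₂−ρ₁)(W₂ − W₁)))/(β − β_h)`.
[cite: Israel1979, Lemma II.3.1] [cite: Israel1979, Thm. I.3.4] [cite: Ruelle1969, §3.3 (3.11)–(3.18)] [cite: PoulinHastings2011, eqs. (3)–(8)] -/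
theorem IsTorusLimitOfMixture.meanEnergy_hubbardTTPrime_le_of_c2Check₂_right_of_cornerMarkovCertificate_left_tPrimeUBox_allTori
    (hn2 : n < 2) {s₀ σ₁ σ₂ : ℝ} (hσ₁ : |s| ≤ σ₁) (hσ₂ : |s - s₀| ≤ σ₂) {U₁ U₂ : ℝ} (hU : U ∈ Set.Icc U₁ U₂)
    (h : ω.IsTorusLimitOfMixture (sectorGibbsCount n) (fun L => sectorGibbsWeightTT' β t s U n L)
      (fun L => sectorGibbsVectorTT' t s U n L) Ls)
    (hLs : Tendsto Ls atTop atTop) {βh : ℝ} (hβh : 0 < βh) (hlt : βh < β)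
    -- C2 at `(β, t, s₀, U₂)`: two checked types on one skeleton
    {a b : ℕ} (ha : 1 ≤ a) (hb : 1 ≤ b) {rows₁ rows₂ : List C2Row} {P₁ K₁ P₂ K₂ q₁ q₂ A₁ A₂ : ℕ}
    {W₁num W₂num : ℤ} {W₁den W₂den : ℕ}
    (h₁ : c2Check P₁ K₁ q₁ A₁ a b rows₁ W₁num W₁den = true) (h₂ : c2Check P₂ K₂ q₂ A₂ a b rows₂ W₂num W₂den = true)
    (hskel : rows₁.map (fun r => (r.sec, r.zn, r.ze)) = rows₂.map (fun r => (r.sec, r.zn, r.ze)))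
    {ρ₁ ρ₂ : ℝ} (hρ₁ : ρ₁ * ((q₁ : ℝ) * a * b) = 2 * A₁) (hρ₂ : ρ₂ * ((q₂ : ℝ) * a * b) = 2 * A₂) (hρ : ρ₁ < ρ₂)
    (hn1 : ρ₁ ≤ n) (hn2' : n ≤ ρ₂)
    (hnode : ∀ r ∈ rows₁,
      r.floor ≤ (partitionFn β (spinSectorHamiltonian r.nu r.nd (hubbardOpenBoxTT' a b t s₀ U₂))).re)
    -- C1 (corner window, `t' = 0`) at `(βh, μ, U₁)`
    (μ : ℝ) {Λ : Finset (Site 2)} {x₀ : Site 2} (hx₀ : x₀ ∈ Λ) (hmax : ∀ y ∈ Λ, toLex y ≤ toLex x₀)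
    (hcorner : ∀ i : Fin 2, x₀ - unitVec i ∈ Λ) {ℓw : ℕ} (hΛ : Λ ⊆ halfOpenBox 2 ℓw)
    {ι : Type*} (sι : Finset ι) (Sw : ι → Finset (Site 2)) (hS : ∀ i, Sw i ⊆ Λ) (zw : ι → Site 2)
    (hzw : ∀ i, shiftSet (zw i) (Sw i) ⊆ Λ) {O : ∀ i, FermionOp (Sw i)} (hO : ∀ i ∈ sι, (O i).IsHermitian)
    (g : ι → ℝ) {LB : FermionOp (Λ.erase x₀)} (hLB : LB.IsHermitian) {c : ℝ}
    (hcert : ((Real.exp c : ℂ) • cfc Real.exp LB -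
      fermionPartialTrace (PolySite.incl (Finset.erase_subset x₀ Λ))
        (cfc Real.exp (-((βh : ℂ) • (cornerEnergyRep Λ x₀ t U₁ μ + windowAnnihilator sι Λ Sw hS zw hzw O g)) +
          fermionEmbed (PolySite.incl (Finset.erase_subset x₀ Λ)) LB))).PosSemidef) :
    ω.meanEnergy (hubbardTTPrimeFermionInteraction t s U) 1 ≤
      ((c - βh * μ * n) + βh * σ₁ * (16 / Real.pi ^ 2) + β * σ₂ * (16 / Real.pi ^ 2) -
        (((W₁num : ℝ) / W₁den) + (n - ρ₁) / (ρ₂ - ρ₁) * (((W₂num : ℝ) / W₂den) - ((W₁num : ℝ) / W₁den)))) /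
        (β - βh) := by
  obtain ⟨-, hq₁, -⟩ := c2Check_sound h₁ ha hb
  have hn0 : 0 ≤ n := by
    have hq₁r : (0 : ℝ) < q₁ := by exact_mod_cast hq₁
    have har : (0 : ℝ) < a := by exact_mod_cast ha
    have hbr : (0 : ℝ) < b := by exact_mod_cast hb
    have hpos : 0 < (q₁ : ℝ) * a * b := by positivity
    have hA : (0 : ℝ) ≤ 2 * A₁ := by positivity
    have hρ₁0 : 0 ≤ ρ₁ := (mul_nonneg_iff_of_pos_right hpos).1 (by rw [hρ₁]; exact hA)
    linarith
  have hβ : 0 < β := hβh.trans hlt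
  set Wc : ℝ := ((W₁num : ℝ) / W₁den) + (n - ρ₁) / (ρ₂ - ρ₁) * (((W₂num : ℝ) / W₂den) - ((W₁num : ℝ) / W₁den))
    with hWc
  -- cold input: the chord floor at `(β, t, s₀, U₂)`, transported to `s` at fixed `U₂`
  have hW0 : ∀ ε : ℝ, 0 < ε → ∀ᶠ j in atTop,
      (Wc - ε) * (Ls j : ℝ) ^ 2 ≤ Real.log (partitionFn β (sectorHamiltonianTT' t s₀ U₂ n (Ls j))).re :=
    fun ε hε => eventually_pressureFloor_chord_of_c2Check₂_of_mem_Icc t s₀ U₂ n hβ.le ha hb h₁ h₂ hskel hρ₁ hρ₂ hρ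
      hn1 hn2' hn2 hnode hLs hε
  have hWs := eventually_mul_sq_le_log_partitionFn_sector_of_tPrime_anchor_floor hn0 hn2 t U₂ hβ s₀ s hLs hW0
  -- hot input: corner C1 at `(βh, t, 0, U₁)`, transported to `s`
  have hu := eventually_log_partitionFn_sector_le_of_cornerMarkovCertificate_tPrimeTransport hn0 hn2 t s U₁ hβh hLs μ hx₀ hmax
    hcorner hΛ sι Sw hS zw hzw hO g hLB hcert
  have hmain := h.meanEnergy_hubbardTTPrime_le_of_pressure_bounds_UCell hn0 hn2.le hU hLs hβh hlt hWs hu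
  refine hmain.trans (div_le_div_of_nonneg_right ?_ (by linarith))
  have hK0 : 0 ≤ 16 / Real.pi ^ 2 := by positivity
  have h1 : βh * |s| * (16 / Real.pi ^ 2) ≤ βh * σ₁ * (16 / Real.pi ^ 2) :=
    mul_le_mul_of_nonneg_right (mul_le_mul_of_nonneg_left hσ₁ hβh.le) hK0
  have h2 : β * |s - s₀| * (16 / Real.pi ^ 2) ≤ β * σ₂ * (16 / Real.pi ^ 2) :=
    mul_le_mul_of_nonneg_right (mul_le_mul_of_nonneg_left hσ₂ hβ.le) hK0
  linarith

/-- **Rectangle corollary, row-file edition** of the cross-corner 3-cell (`16/π²` replaced by `16212/10000`):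
`e_Φ(ω) ≤ ((c − β_h μ n) + β_h σ₁ K + β σ₂ K − (W₁ + (n−ρ₁)/(ρ₂−ρ₁)(W₂ − W₁)))/(β − β_h)`, `K = 16212/10000`.
[cite: Israel1979, Lemma II.3.1] [cite: Israel1979, Thm. I.3.4] [cite: Ruelle1969, §3.3 (3.11)–(3.18)] [cite: PoulinHastings2011, eqs. (3)–(8)] -/
theorem IsTorusLimitOfMixture.meanEnergy_hubbardTTPrime_le_of_c2Check₂_right_of_rectMarkovCertificate_left_tPrimeUBox_allTori'
    (hn2 : n < 2) {s₀ σ₁ σ₂ : ℝ} (hσ₁ : |s| ≤ σ₁) (hσ₂ : |s - s₀| ≤ σ₂) {U₁ U₂ : ℝ} (hU : U ∈ Set.Icc U₁ U₂)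
    (h : ω.IsTorusLimitOfMixture (sectorGibbsCount n) (fun L => sectorGibbsWeightTT' β t s U n L)
      (fun L => sectorGibbsVectorTT' t s U n L) Ls)
    (hLs : Tendsto Ls atTop atTop) {βh : ℝ} (hβh : 0 < βh) (hlt : βh < β)
    {a b : ℕ} (ha : 1 ≤ a) (hb : 1 ≤ b) {rows₁ rows₂ : List C2Row} {P₁ K₁ P₂ K₂ q₁ q₂ A₁ A₂ : ℕ}
    {W₁num W₂num : ℤ} {W₁den W₂den : ℕ}
    (h₁ : c2Check P₁ K₁ q₁ A₁ a b rows₁ W₁num W₁den = true) (h₂ : c2Check P₂ K₂ q₂ A₂ a b rows₂ W₂num W₂den = true)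
    (hskel : rows₁.map (fun r => (r.sec, r.zn, r.ze)) = rows₂.map (fun r => (r.sec, r.zn, r.ze)))
    {ρ₁ ρ₂ : ℝ} (hρ₁ : ρ₁ * ((q₁ : ℝ) * a * b) = 2 * A₁) (hρ₂ : ρ₂ * ((q₂ : ℝ) * a * b) = 2 * A₂) (hρ : ρ₁ < ρ₂)
    (hn1 : ρ₁ ≤ n) (hn2' : n ≤ ρ₂)
    (hnode : ∀ r ∈ rows₁,
      r.floor ≤ (partitionFn β (spinSectorHamiltonian r.nu r.nd (hubbardOpenBoxTT' a b t s₀ U₂))).re)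
    (μ : ℝ) {a' b' : ℕ} (ha' : 2 ≤ a') (hb' : 2 ≤ b')
    {ι : Type*} (sι : Finset ι) (Sw : ι → Finset (Site 2)) (hS : ∀ i, Sw i ⊆ rectWindow a' b') (zw : ι → Site 2)
    (hzw : ∀ i, shiftSet (zw i) (Sw i) ⊆ rectWindow a' b') {O : ∀ i, FermionOp (Sw i)}
    (hO : ∀ i ∈ sι, (O i).IsHermitian) (g : ι → ℝ)
    {LB : FermionOp ((rectWindow a' b').erase (mkSite2 (a' - 1) (b' - 1)))} (hLB : LB.IsHermitian) {c : ℝ}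
    (hcert : ((Real.exp c : ℂ) • cfc Real.exp LB -
      fermionPartialTrace (PolySite.incl (Finset.erase_subset (mkSite2 (a' - 1) (b' - 1)) (rectWindow a' b')))
        (cfc Real.exp (-((βh : ℂ) • (cornerEnergyRep (rectWindow a' b') (mkSite2 (a' - 1) (b' - 1)) t U₁ μ +
            windowAnnihilator sι (rectWindow a' b') Sw hS zw hzw O g)) +
          fermionEmbed (PolySite.incl (Finset.erase_subset (mkSite2 (a' - 1) (b' - 1)) (rectWindow a' b'))) LB))).PosSemidef) :
    ω.meanEnergy (hubbardTTPrimeFermionInteraction t s U) 1 ≤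
      ((c - βh * μ * n) + βh * σ₁ * (16212 / 10000) + β * σ₂ * (16212 / 10000) -
        (((W₁num : ℝ) / W₁den) + (n - ρ₁) / (ρ₂ - ρ₁) * (((W₂num : ℝ) / W₂den) - ((W₁num : ℝ) / W₁den)))) /
        (β - βh) := by
  have hmain := h.meanEnergy_hubbardTTPrime_le_of_c2Check₂_right_of_cornerMarkovCertificate_left_tPrimeUBox_allTori hn2 hσ₁ hσ₂
    hU hLs hβh hlt ha hb h₁ h₂ hskel hρ₁ hρ₂ hρ hn1 hn2' hnode μ (rectCorner_mem_rectWindow (by omega) (by omega))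
    toLex_le_toLex_rectCorner (rectCorner_sub_unitVec_mem_rectWindow ha' hb') (rectWindow_subset_halfOpenBox_max a' b')
    sι Sw hS zw hzw hO g hLB hcert
  refine hmain.trans (div_le_div_of_nonneg_right ?_ (by linarith))
  have hK := sixteen_div_pi_sq_lt.le
  have hσ₁0 : 0 ≤ σ₁ := (abs_nonneg s).trans hσ₁
  have hσ₂0 : 0 ≤ σ₂ := (abs_nonneg _).trans hσ₂
  have h1 := mul_le_mul_of_nonneg_left hK (mul_nonneg hβh.le hσ₁0)
  have h2 := mul_le_mul_of_nonneg_left hK (mul_nonneg (hβh.trans hlt).le hσ₂0)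
  linarith

end InfVolFermionState

end Literature.MathematicalPhysics.QuantumLattice

end
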